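import Mathlib
import HarnessLib
import Summits.Ventures.LatticeQCDFlow.Exactness.NCMCGeneralSpaceReplicaJackknifeDeltaMethod

/-!
# The delete-one-block JACKKNIFE of the POOLED RATIO estimator (`reweighted_mean ± err`, `sector_weights`) has the replica-`t` limiting coverage `L_R(q)`

HONEST FRAMING: exact (Metropolis-corrected) sampling algorithms for lattice gauge theory;
figures of merit are autocorrelation/cost numbers at stated couplings and volumes; no
continuum-physics claim.

Venture `LatticeQCDFlow` (cell pub-lqcd), topic `Exactness`; FANOUT row 13 (`eng-snf`, GEN-25).
NEW WORK of the cell (elementary asymptotic statistics) against Mathlib and GEN-25's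
`NCMCGeneralSpaceReplicaJackknifeDeltaMethod` (the perturbed replica-`t` coverage lemma and the
jackknife algebra); not a published result; no definition; nothing cited as a fact.

WHY (row 13).  `latflow-snf`'s `estimators.reweighted_mean` (FITNESS 'reweight' mode; also
`sector_weights`, the reweighted topological-sector populations) prints the POOLED RATIO
`⟨O⟩ = Σ_i O_i w_i / Σ_i w_i` over all records and its delete-one-block jackknife error
`err = √(((R−1)/R) Σ_r (ρ̂_{(−r)} − ρ̄_{(·)})²)`,
`ρ̂_{(−r)} = Σ_{i∉block r} O_i w_i / Σ_{i∉block r} w_i`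
(`estimators.jackknife` verbatim; `mean_biascorr = R·ρ̂ − (R−1)·ρ̄_{(·)}`).  With `R` blocks of
equal length `n` and block means `X_r` of `O·w`, `Y_r` of `w`, `ρ̂_S = (Σ_{r∈S} X_r)/(Σ_{r∈S} Y_r)`.
The ratio is NOT a function of one pooled mean, so GEN-25's `…JackknifeDeltaMethod` does not
apply verbatim; but `ρ̂_S − θ = (Σ_{r∈S} U_r)/(Σ_{r∈S} Y_r)` with the SINGLE observable
`U_r = X_r − θ Y_r` (block mean of `u_θ = (O − θ)·w`), so with `v_r = √n U_r` EXACTLY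
`√n (ρ̂_S − θ) = (Σ_S v_r)/(Σ_S Y_r)`: the studentised deviation is a fixed function `Ψ(v, Y)`
of the scalar replica vector `v` and the weight block means `Y`.  Hence (this file): if
`(√n U_{n,r})_r ⇒ N(0, σ²)^{⊗R}` (`σ² ≠ 0`; GEN-22/23's chain CLTs for the bounded observable
`u_θ`, independent or branched starts) and `Y_{n,r} → b ≠ 0` in probability for each block
(ergodic averages of the positive weight), then for every `q ≥ 0` and every bias-correction
weight `κ` (`κ = 0`: `mean ± q·err`; `κ = R − 1`: `mean_biascorr ± q·err`) the coverage tends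
to `L_R(q) = N(0,1)^{⊗R}{|t| ≤ q}` — the same universal limit as every other bar of the engine.

* `tendstoInMeasure_pi_const_of_forall` (§1) — coordinatewise convergence in probability to a
  constant is convergence in the sup norm (finitely many coordinates).
* `mul_sum_div_sum_sub_eq` (§1) — `s (Σ_S X / Σ_S Y − θ) = (Σ_S s (X_r − θ Y_r)) / Σ_S Y`.
* **`tendsto_measure_abs_pooledRatioJackknife_le`** (§2, free `κ`) and **`…_mean`** (`κ = 0`).

NOT CLAIMED: weights that may vanish (we assume every block mean of `w` is positive, as for
`w = e^{−W}`); unequal block lengths; `R → ∞` with `n`; anything numerical.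
-/

namespace Summit.Ventures.LatticeQCDFlow.Exactness.GeneralNCMC

open MeasureTheory ProbabilityTheory Filter Finset WithLp
open scoped ENNReal NNReal Topology

/-! ## §1 Two small tools -/

section Tools

variable {ι : Type*} [Fintype ι]
  {Ω₀ : Type*} [MeasurableSpace Ω₀] {P : Measure Ω₀} [IsProbabilityMeasure P]

omit [IsProbabilityMeasure P] in
/-- **Coordinatewise convergence in probability to a constant is convergence in the sup norm**
(finitely many coordinates): `Y_{n,r} → b_r` in probability for every `r` ⇒ `Y_n → b` in
probability in `ι → ℝ`. -/
theorem tendstoInMeasure_pi_const_of_forall {Y : ℕ → Ω₀ → ι → ℝ} {b : ι → ℝ}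
    (h : ∀ r, TendstoInMeasure P (fun n ω => Y n ω r) atTop (fun _ => b r)) :
    TendstoInMeasure P Y atTop (fun _ => b) := by
  rw [tendstoInMeasure_iff_norm]
  intro ε hε
  have hsub : ∀ n, {ω | ε ≤ ‖Y n ω - b‖} ⊆ ⋃ r, {ω | ε ≤ ‖Y n ω r - b r‖} := by
    intro n ω hω
    by_contra hall
    simp only [Set.mem_iUnion, Set.mem_setOf_eq, not_exists, not_le] at hall
    exact absurd ((pi_norm_lt_iff hε).2 fun r => by simpa using hall r) (not_lt.2 hω)
  have hle : ∀ n, P {ω | ε ≤ ‖Y n ω - b‖} ≤ ∑ r, P {ω | ε ≤ ‖Y n ω r - b r‖} :=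
    fun n => (measure_mono (hsub n)).trans (measure_iUnion_fintype_le _ _)
  have hsum : Tendsto (fun n => ∑ r, P {ω | ε ≤ ‖Y n ω r - b r‖}) atTop (𝓝 0) := by
    rw [← Finset.sum_const_zero]
    exact tendsto_finsetSum _ fun r _ => (tendstoInMeasure_iff_norm.1 (h r)) ε hε
  exact tendsto_of_tendsto_of_tendsto_of_le_of_le' tendsto_const_nhds hsum
    (Eventually.of_forall fun n => bot_le) (Eventually.of_forall hle)

omit [Fintype ι] in
/-- **The ratio identity**: `s (Σ_S X / Σ_S Y − θ) = (Σ_{r∈S} s (X_r − θ Y_r)) / Σ_S Y`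
(`Σ_S Y ≠ 0`) — a pooled ratio minus its target is a pooled SUM of the single observable
`X − θ Y` over the pooled weight. -/
theorem mul_sum_div_sum_sub_eq (S : Finset ι) (X Y : ι → ℝ) (θ s : ℝ) (hY : ∑ r ∈ S, Y r ≠ 0) :
    s * ((∑ r ∈ S, X r) / (∑ r ∈ S, Y r) - θ) = (∑ r ∈ S, s * (X r - θ * Y r)) / ∑ r ∈ S, Y r := by
  rw [← mul_sum, sum_sub_distrib, ← mul_sum]
  field_simp

omit [Fintype ι] in
/-- At a constant weight vector the pooled ratio of sums is the mean divided by the constant: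
`(Σ_S z)/(Σ_S b) = b⁻¹ · ((Σ_S z)/|S|)`. -/
theorem sum_div_sum_const_eq (S : Finset ι) (z : ι → ℝ) (b : ℝ) :
    (∑ r ∈ S, z r) / (∑ _r ∈ S, b) = b⁻¹ * ((∑ r ∈ S, z r) / S.card) := by
  rw [sum_const, nsmul_eq_mul]
  rcases eq_or_ne b 0 with hb | hb
  · simp [hb]
  rcases eq_or_ne (S.card : ℝ) 0 with hS | hS
  · simp [hS]
  field_simp

end Tools

/-! ## §2 The pooled-ratio jackknife bar has limiting coverage `L_R(q)` -/

section Ratio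

variable {ι : Type*} [Fintype ι] [DecidableEq ι] [Nontrivial ι]
  {Ω₀ : Type*} [MeasurableSpace Ω₀] {P : Measure Ω₀} [IsProbabilityMeasure P]

/-- **THE POOLED RATIO JACKKNIFE BAR COVERS WITH PROBABILITY `→ L_R(q)`** (free bias-correction
weight `κ`; `κ = R − 1` is `mean_biascorr`).  Numerator/weight block means `X_n, Y_n : Ω → (ι → ℝ)`
(`R = card ι ≥ 2`; `Y_n` measurable with every `Y_{n,r} > 0` for `n ≥ 1`; nothing asked of `X_n`
beyond the CLT), a target `θ`, the replica-vector CLT for the single observable `U = X − θ Y`: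
`(√n U_{n,r})_r ⇒ N(0, v)^{⊗R}` (`v ≠ 0`), and `Y_{n,r} → b ≠ 0` in probability for each `r`.
Then for every `κ` and `q ≥ 0` the probability that `|ρ̂_n + κ(ρ̂_n − ρ̄_{(·),n}) − θ|` is at most
`q·√(((R−1)/R) Σ_r (ρ̂_{(−r),n} − ρ̄_{(·),n})²)` (as the studentised ratio), `ρ̂_S = Σ_S X / Σ_S Y`,
tends to `N(0,1)^{⊗R}{|t| ≤ q}`. -/
theorem tendsto_measure_abs_pooledRatioJackknife_le {X Y : ℕ → Ω₀ → ι → ℝ}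
    (hYm : ∀ n, Measurable (Y n)) (hYpos : ∀ n ω r, 0 < n → 0 < Y n ω r)
    {θ b : ℝ} (hb : b ≠ 0) {v : ℝ≥0} (hv : v ≠ 0)
    (hV : TendstoInDistribution
      (fun (n : ℕ) ω => toLp 2 (fun r => Real.sqrt (n : ℝ) * (X n ω r - θ * Y n ω r)))
      atTop (toLp 2) (fun _ => P) (Measure.pi fun _ : ι => gaussianReal 0 v))
    (hYb : ∀ r, TendstoInMeasure P (fun n ω => Y n ω r) atTop (fun _ => b))
    (κ : ℝ) {q : ℝ} (hq : 0 ≤ q) :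
    Tendsto (fun n => P {ω |
      |((∑ r, X n ω r) / (∑ r, Y n ω r)
          + κ * ((∑ r, X n ω r) / (∑ r, Y n ω r)
            - (∑ t, (∑ r ∈ univ.erase t, X n ω r) / (∑ r ∈ univ.erase t, Y n ω r))
                / Fintype.card ι)
          - θ)
        / Real.sqrt (((Fintype.card ι : ℝ) - 1) / Fintype.card ι
          * ∑ r, ((∑ u ∈ univ.erase r, X n ω u) / (∑ u ∈ univ.erase r, Y n ω u)
            - (∑ t, (∑ u ∈ univ.erase t, X n ω u) / (∑ u ∈ univ.erase t, Y n ω u))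
                / Fintype.card ι) ^ 2)| ≤ q}) atTop
      (𝓝 ((Measure.pi fun _ : ι => gaussianReal 0 1) {z : ι → ℝ | |(∑ r, z r) / Fintype.card ι
        / Real.sqrt ((∑ r, (z r - (∑ r', z r') / Fintype.card ι) ^ 2)
            / ((Fintype.card ι : ℝ) * (Fintype.card ι - 1)))| ≤ q})) := by
  have hR2 : (2 : ℝ) ≤ Fintype.card ι := by
    exact_mod_cast (Fintype.one_lt_card : 2 ≤ Fintype.card ι)
  have hR0 : (Fintype.card ι : ℝ) ≠ 0 := by positivity
  have hR1 : (Fintype.card ι : ℝ) - 1 ≠ 0 := by linarith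
  have hRpos : (0 : ℝ) < (Fintype.card ι : ℝ) * (Fintype.card ι - 1) :=
    mul_pos (by linarith) (by linarith)
  set P' : Measure (ι → ℝ) := Measure.pi fun _ : ι => gaussianReal 0 v with hP'
  -- the scale-free function of (scaled `U`-block means, weight block means)
  set Ψ : PiLp 2 (fun _ : ι => ℝ) × (ι → ℝ) → ℝ := fun p =>
    ((∑ r, p.1 r) / (∑ r, p.2 r)
        + κ * ((∑ r, p.1 r) / (∑ r, p.2 r)
          - (∑ t, (∑ r ∈ univ.erase t, p.1 r) / (∑ r ∈ univ.erase t, p.2 r)) / Fintype.card ι))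
      / Real.sqrt (((Fintype.card ι : ℝ) - 1) / Fintype.card ι
        * ∑ r, ((∑ u ∈ univ.erase r, p.1 u) / (∑ u ∈ univ.erase r, p.2 u)
          - (∑ t, (∑ u ∈ univ.erase t, p.1 u) / (∑ u ∈ univ.erase t, p.2 u))
              / Fintype.card ι) ^ 2) with hΨ
  have hΨm : Measurable Ψ := by rw [hΨ]; fun_prop
  have hY : TendstoInMeasure P (fun n ω => Y n ω) atTop (fun _ => fun _ : ι => b) :=
    tendstoInMeasure_pi_const_of_forall hYb
  -- the value `Ψ(z, b) = (b⁻¹/|b⁻¹|) · t(z)` for EVERY `z`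
  have hloo : ∀ (z : ι → ℝ) t, (∑ r ∈ univ.erase t, (toLp 2 z : PiLp 2 (fun _ : ι => ℝ)) r)
      / (∑ _r ∈ univ.erase t, b) = b⁻¹ * ((∑ r ∈ univ.erase t, z r) / ((Fintype.card ι : ℝ) - 1)) :=
    fun z t => by rw [sum_div_sum_const_eq, card_univ_erase_cast]
  have hfull : ∀ z : ι → ℝ, (∑ r, (toLp 2 z : PiLp 2 (fun _ : ι => ℝ)) r) / (∑ _r : ι, b)
      = b⁻¹ * ((∑ r, z r) / Fintype.card ι) :=
    fun z => by rw [sum_div_sum_const_eq, card_univ]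
  have hval : ∀ z : ι → ℝ, Ψ (toLp 2 z, fun _ : ι => b)
      = b⁻¹ / |b⁻¹| * ((∑ r, z r) / Fintype.card ι
        / Real.sqrt ((∑ r, (z r - (∑ r', z r') / Fintype.card ι) ^ 2)
            / ((Fintype.card ι : ℝ) * (Fintype.card ι - 1)))) := by
    intro z
    simp only [hΨ, hloo, hfull]
    rw [jackknife_variance_const_mul_looMean hR0 hR1 z b⁻¹, sum_const_mul_looMean_div hR1 z b⁻¹,
      sub_self, mul_zero, add_zero, Real.sqrt_mul (sq_nonneg b⁻¹), Real.sqrt_sq_eq_abs,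
      mul_div_mul_comm]
  -- continuity of `Ψ` at `(z, b)` off the diagonal
  have hcont : ∀ᵐ z ∂P', ContinuousAt Ψ (toLp 2 z, fun _ : ι => b) := by
    filter_upwards [ae_sumSqDev_ne_zero_pi_gaussianReal (ι := ι) 0 hv] with z hz
    set p₀ : PiLp 2 (fun _ : ι => ℝ) × (ι → ℝ) := (toLp 2 z, fun _ : ι => b) with hp₀
    have hc1 : ∀ S : Finset ι, Continuous fun p : PiLp 2 (fun _ : ι => ℝ) × (ι → ℝ) =>
        ∑ r ∈ S, p.1 r := fun S => by fun_prop
    have hc2 : ∀ S : Finset ι, Continuous fun p : PiLp 2 (fun _ : ι => ℝ) × (ι → ℝ) =>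
        ∑ r ∈ S, p.2 r := fun S => by fun_prop
    -- every pooled weight is non-zero at the limit point
    have hden : ∀ S : Finset ι, S.Nonempty →
        (fun p : PiLp 2 (fun _ : ι => ℝ) × (ι → ℝ) => ∑ r ∈ S, p.2 r) p₀ ≠ 0 := by
      intro S hS
      simp only [hp₀, sum_const, nsmul_eq_mul]
      exact mul_ne_zero (Nat.cast_ne_zero.2 (card_pos.2 hS).ne') hb
    have hne : ∀ t : ι, (univ.erase t).Nonempty := fun t => by
      obtain ⟨s, hs⟩ := exists_ne t
      exact ⟨s, mem_erase.2 ⟨hs, mem_univ s⟩⟩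
    have hq0 : ContinuousAt (fun p : PiLp 2 (fun _ : ι => ℝ) × (ι → ℝ) =>
        (∑ r, p.1 r) / (∑ r, p.2 r)) p₀ :=
      (hc1 univ).continuousAt.div (hc2 univ).continuousAt (hden univ univ_nonempty)
    have hqt : ∀ t, ContinuousAt (fun p : PiLp 2 (fun _ : ι => ℝ) × (ι → ℝ) =>
        (∑ r ∈ univ.erase t, p.1 r) / (∑ r ∈ univ.erase t, p.2 r)) p₀ := fun t =>
      (hc1 _).continuousAt.div (hc2 _).continuousAt (hden _ (hne t))
    have hS : ContinuousAt (fun p : PiLp 2 (fun _ : ι => ℝ) × (ι → ℝ) =>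
        (∑ t, (∑ r ∈ univ.erase t, p.1 r) / (∑ r ∈ univ.erase t, p.2 r))
          / (Fintype.card ι : ℝ)) p₀ :=
      (tendsto_finsetSum _ fun t _ => hqt t).div_const _
    have hJpos : 0 < b⁻¹ ^ 2 * ((∑ r, (z r - (∑ s, z s) / Fintype.card ι) ^ 2)
          / ((Fintype.card ι : ℝ) * (Fintype.card ι - 1))) :=
      mul_pos (by positivity) (div_pos (lt_of_le_of_ne (sum_nonneg fun r _ => sq_nonneg _)
        (Ne.symm hz)) hRpos)
    rw [hΨ]
    refine (hq0.add (continuousAt_const.mul (hq0.sub hS))).div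
      (Real.continuous_sqrt.continuousAt.comp (continuousAt_const.mul
        (tendsto_finsetSum _ fun r _ => ((hqt r).sub hS).pow 2))) ?_
    simp only [hp₀, hloo]
    rw [jackknife_variance_const_mul_looMean hR0 hR1 z b⁻¹]
    exact (Real.sqrt_pos.2 hJpos).ne'
  have hσ : |(b⁻¹ / |b⁻¹|)| = 1 := by
    rw [abs_div, abs_abs, div_self (abs_ne_zero.2 (inv_ne_zero hb))]
  refine tendsto_measure_abs_le_of_perturbed_tStat hv hV hY
    (fun n => (hYm n).aemeasurable) hΨm hσ hcont (Eventually.of_forall hval) ?_ hq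
  -- the exact `√n`-scaling identity, for `n ≥ 1`
  filter_upwards [eventually_gt_atTop 0] with n hn ω
  have hs : 0 < Real.sqrt (n : ℝ) := Real.sqrt_pos.2 (by exact_mod_cast hn)
  have hYS : ∀ S : Finset ι, S.Nonempty → ∑ r ∈ S, Y n ω r ≠ 0 := fun S hS =>
    (sum_pos (fun r _ => hYpos n ω r hn) hS).ne'
  have hne : ∀ t : ι, (univ.erase t).Nonempty := fun t => by
    obtain ⟨s, hs'⟩ := exists_ne t
    exact ⟨s, mem_erase.2 ⟨hs', mem_univ s⟩⟩
  rw [hΨ, studentised_biasCorrected_scale _ θ κ _ hs]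
  rw [mul_sum_div_sum_sub_eq univ _ _ θ _ (hYS univ univ_nonempty)]
  simp_rw [mul_sum_div_sum_sub_eq (univ.erase _) _ _ θ _ (hYS _ (hne _))]

/-- **`reweighted_mean`'s `mean ± q·err` (`κ = 0`)**: the delete-one-block jackknife bar around the
POOLED RATIO `Σ O w / Σ w` has limiting coverage `L_R(q) = N(0,1)^{⊗R}{|t| ≤ q}`. -/
theorem tendsto_measure_abs_pooledRatioJackknife_le_mean {X Y : ℕ → Ω₀ → ι → ℝ}
    (hYm : ∀ n, Measurable (Y n)) (hYpos : ∀ n ω r, 0 < n → 0 < Y n ω r)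
    {θ b : ℝ} (hb : b ≠ 0) {v : ℝ≥0} (hv : v ≠ 0)
    (hV : TendstoInDistribution
      (fun (n : ℕ) ω => toLp 2 (fun r => Real.sqrt (n : ℝ) * (X n ω r - θ * Y n ω r)))
      atTop (toLp 2) (fun _ => P) (Measure.pi fun _ : ι => gaussianReal 0 v))
    (hYb : ∀ r, TendstoInMeasure P (fun n ω => Y n ω r) atTop (fun _ => b))
    {q : ℝ} (hq : 0 ≤ q) :
    Tendsto (fun n => P {ω |
      |((∑ r, X n ω r) / (∑ r, Y n ω r) - θ)
        / Real.sqrt (((Fintype.card ι : ℝ) - 1) / Fintype.card ι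
          * ∑ r, ((∑ u ∈ univ.erase r, X n ω u) / (∑ u ∈ univ.erase r, Y n ω u)
            - (∑ t, (∑ u ∈ univ.erase t, X n ω u) / (∑ u ∈ univ.erase t, Y n ω u))
                / Fintype.card ι) ^ 2)| ≤ q}) atTop
      (𝓝 ((Measure.pi fun _ : ι => gaussianReal 0 1) {z : ι → ℝ | |(∑ r, z r) / Fintype.card ι
        / Real.sqrt ((∑ r, (z r - (∑ r', z r') / Fintype.card ι) ^ 2)
            / ((Fintype.card ι : ℝ) * (Fintype.card ι - 1)))| ≤ q})) := by
  refine (tendsto_measure_abs_pooledRatioJackknife_le hYm hYpos hb hv hV hYb 0 hq).congr' ?_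
  refine Eventually.of_forall fun n => ?_
  simp only [zero_mul, add_zero]

end Ratio

end Summit.Ventures.LatticeQCDFlow.Exactness.GeneralNCMC
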